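import Mathlib
import Summits.Ventures.HodgeRepro.Tier4.Common.UnitaryHyperbolicGrowth
import Summits.Ventures.HodgeRepro.Tier4.Line4.ArchBallProduct
import Summits.Ventures.HodgeRepro.Tier4.Line4.SliceModelUnitary

/-!
# Tier4/Line4/SliceBallGrowth — STAGE C of C-COMMON-SL2BALL: the slice `G_{w₀}` of the row plane at a real CM place of
signature `(1,1)` has `SliceBallGrowth` (rate `5/2 < 3`) — the ball growth of `U(J)` transported along
`atPlace W w₀ ≃ₜ* U(J)`

Blind re-derivation cell `pub-hodge-repro`, Tier 4 «prove the step» (README §9–§10), seat t4-L4-p2 (prover, LINE L4,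
gen 5; cut C2 of C-COMMON-SL2BALL stage C, statement S15613 (M3), on typer-2's route S15611 «transport
`haar_logSublevel_le_exp_UJ` along the iso»).  Tree path `lean/Summits/Ventures/HodgeRepro/Tier4/Line4/SliceBallGrowth.lean`.
Mathlib-level; no literature.  Imports typer-2's `Common/UnitaryHyperbolicGrowth` (`SL2Ball.haar_logSublevel_le_exp_UJ`:
every Haar measure of `U(J)`, `J` of signature `(1,1)`, has `μ {log⁺ l1C ≤ T} ≤ C e^{(2+ε)T}` for `T ≥ 0` — stages A, B and
C1 of the SL2BALL chain), L1-p2's `Line4/ArchBallProduct` (`SliceBallGrowth`, `sliceBallGrowth_of_logSublevel`) and this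
seat's `Line4/SliceModelUnitary` (`localModel`, `l1C_locOf_le`; through it `SliceModel`, `LocalBlocks`, `LocalAssembly`:
`sliceEquiv`, `componentAt`).

THE ARGUMENT.  (R1, crit-2 S15616 (i) / crit-1 S15617) **`archSizeAt_eq_sum_norm_componentAt`** — the skeleton's
`archSizeAt W w₀ g` (L1ClassV3: `∑_{ij} ‖adToC w₀ (g_{ij})‖`) IS the `ℓ¹` norm `∑_{ij} ‖ι ((componentAt g)_{ij})‖` of the
`w₀`-component (`adToC = extensionEmbedding ∘ adComponentInf`), a named theorem.  **`sliceModel`** :=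
`sliceEquiv.trans localModel : atPlace W w₀ ≃ₜ* U(J)`, with `l1C (sliceModel g) ≤ (1 + ‖ω‖) · archSizeAt w₀ g`
(`l1C_sliceModel_le`, from `l1C_locOf_le`).  For a Haar `ν` on the slice, `μ := map sliceModel ν` is Haar on `U(J)`
(Mathlib's `ContinuousMulEquiv.isHaarMeasure_map`); typer-2's bound at `ε = 1/2` gives `μ {log⁺ l1C ≤ T} ≤ C e^{5T/2}`;
the sublevel set `{log⁺ archSizeAt ≤ T}` of the slice lies in the preimage of `{log⁺ l1C ≤ T + log (1 + ‖ω‖)}`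
(`archSizeAt ≤ e^T ⇒ l1C ≤ (1 + ‖ω‖) e^T`), and `ν (preimage) = μ (…)` (a measurable equivalence, every set); the shift
`log (1 + ‖ω‖)` is absorbed in the constant `C (1 + ‖ω‖)^{5/2}`.  L1-p2's `sliceBallGrowth_of_logSublevel` turns the
`T ≥ 0` bound into `SliceBallGrowth` over all `T` (the `T < 0` case, crit-1 S15546).

  **`sliceBallGrowth_ofLinesRow (hw) (hcm) (hq) (hα : 0 < alphaLoc a hw) (hβ : betaLoc b ε hw < 0) (ν) [Haar] :
  SliceBallGrowth (ofLinesRow q a b ε) w₀ ν`**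

— the `hslice` binder of L1-p2's `archBallGrowth_of_slice`, with NO constant binder (crit-2 S15616 (ii)); the signs
`a_{w₀} > 0 > (ε b)_{w₀}` are the indefiniteness of the row plane at `w₀` (the (7a) `_hpos` / `IsCMAt` side on the line's
mixed plane, `ε = −1`, `a_{w₀}, b_{w₀} > 0`).  With L1-p1's DEF-COMPACT (`hcpt`) the (8) chain of record reads
`ArchBallGrowth W μ∞ ⇐ archBallGrowth_of_slice hcpt (sliceBallGrowth_ofLinesRow …)`.

Nothing here says anything about the status of the Hodge conjecture for CM abelian varieties, which is NOT proved
(HC_CM is NOT proved by anyone in this repository).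
-/

set_option autoImplicit false

noncomputable section

namespace Summit.Ventures.HodgeRepro.Tier4.Line4

open Summit.Ventures.HodgeRepro.Tier4.Common Summit.Ventures.HodgeRepro.Tier4.Common.SL2Ball
  Summit.Ventures.HodgeRepro.Tier4.Line4.L1Class MeasureTheory NumberField Matrix Topology

open scoped ENNReal NNReal

section Size

variable {k : Type} [Field k] [NumberField k] (W : PlaneData k) (w₀ : InfinitePlace k)

/-- **(R1) `archSizeAt` is the `ℓ¹` norm of the `w₀`-component**: `archSizeAt W w₀ g = ∑_{ij} ‖ι ((g_{w₀})_{ij})‖`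
(`adToC w₀ = extensionEmbedding w₀ ∘ adComponentInf k w₀`, and the `w₀`-component's entries are `adComponentInf` of the
entries). -/
theorem archSizeAt_eq_sum_norm_infiniteComponent (g : GA W) :
    archSizeAt W w₀ g = ∑ i : Fin 4, ∑ j : Fin 4, ‖iota w₀
      (((GA.infiniteComponent W w₀ g : GL (Fin 4) w₀.Completion) : Matrix (Fin 4) (Fin 4) w₀.Completion) i j)‖ :=
  rfl

/-- **(R1) on the slice**: `archSizeAt W w₀ g = ∑_{ij} ‖ι ((componentAt g)_{ij})‖` for `g ∈ atPlace W w₀`. -/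
theorem archSizeAt_eq_sum_norm_componentAt (g : atPlace W w₀) :
    archSizeAt W w₀ (g : GA W) = ∑ i : Fin 4, ∑ j : Fin 4, ‖iota w₀
      ((((componentAt W w₀ g : localUnitary W w₀) : GL (Fin 4) w₀.Completion) :
        Matrix (Fin 4) (Fin 4) w₀.Completion) i j)‖ :=
  rfl

end Size

section Slice

variable {k : Type} [Field k] [NumberField k] (q : QuadData k) (a b ε : k) {w₀ : InfinitePlace k}

/-- **The slice model**: `atPlace W w₀ ≃ₜ* U(J)` for the row plane at a real CM place (`sliceEquiv` then `localModel`). -/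
def sliceModel (hw : w₀.IsReal) (hcm : IsCMAt q w₀) (hq : 4 * q.n - q.t ^ 2 ≠ 0) :
    atPlace (PlaneData.ofLinesRow q a b ε) w₀ ≃ₜ* UJ (alphaLoc a hw) (betaLoc b ε hw) :=
  (sliceEquiv (PlaneData.ofLinesRow q a b ε) w₀).trans (localModel q a b ε hw hcm hq)

/-- The value of the slice model: the complex reading of the `w₀`-component. -/
theorem coe_sliceModel_apply (hw : w₀.IsReal) (hcm : IsCMAt q w₀) (hq : 4 * q.n - q.t ^ 2 ≠ 0)
    (g : atPlace (PlaneData.ofLinesRow q a b ε) w₀) :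
    (((sliceModel q a b ε hw hcm hq g : UJ (alphaLoc a hw) (betaLoc b ε hw)) : GL (Fin 2) ℂ) :
      Matrix (Fin 2) (Fin 2) ℂ) =
      locOf q w₀ (((componentAt (PlaneData.ofLinesRow q a b ε) w₀ g : localUnitary (PlaneData.ofLinesRow q a b ε) w₀) :
        GL (Fin 4) w₀.Completion) : Matrix (Fin 4) (Fin 4) w₀.Completion) :=
  rfl

/-- **The size comparison on the slice**: `l1C (sliceModel g) ≤ (1 + ‖ω‖) · archSizeAt W w₀ g`. -/
theorem l1C_sliceModel_le (hw : w₀.IsReal) (hcm : IsCMAt q w₀) (hq : 4 * q.n - q.t ^ 2 ≠ 0)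
    (g : atPlace (PlaneData.ofLinesRow q a b ε) w₀) :
    l1C (((sliceModel q a b ε hw hcm hq g : UJ (alphaLoc a hw) (betaLoc b ε hw)) : GL (Fin 2) ℂ) :
      Matrix (Fin 2) (Fin 2) ℂ) ≤
      (1 + ‖wroot q w₀‖) * archSizeAt (PlaneData.ofLinesRow q a b ε) w₀ (g : GA (PlaneData.ofLinesRow q a b ε)) := by
  rw [coe_sliceModel_apply, archSizeAt_eq_sum_norm_componentAt]
  exact l1C_locOf_le q _

/-- **STAGE C — the slice ball growth of the row plane at a real CM place of signature `(1,1)`**: every Haar measure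
`ν` on `atPlace (ofLinesRow q a b ε) w₀` satisfies `SliceBallGrowth` with rate `5/2 < 3`.  The ball growth of `U(J)`
(typer-2's `haar_logSublevel_le_exp_UJ` at `ε = 1/2`) transported along `sliceModel`; the size comparison
`l1C ≤ (1 + ‖ω‖) archSizeAt` shifts `T` by `log (1 + ‖ω‖)`, absorbed in the constant. -/
theorem sliceBallGrowth_ofLinesRow (hw : w₀.IsReal) (hcm : IsCMAt q w₀) (hq : 4 * q.n - q.t ^ 2 ≠ 0)
    (hα : 0 < alphaLoc a hw) (hβ : betaLoc b ε hw < 0)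
    [MeasurableSpace (GA (PlaneData.ofLinesRow q a b ε))] [BorelSpace (GA (PlaneData.ofLinesRow q a b ε))]
    (ν : Measure (atPlace (PlaneData.ofLinesRow q a b ε) w₀)) [ν.IsHaarMeasure] :
    SliceBallGrowth (PlaneData.ofLinesRow q a b ε) w₀ ν := by
  set e := sliceModel q a b ε hw hcm hq with he
  letI : MeasurableSpace (UJ (alphaLoc a hw) (betaLoc b ε hw)) := borel _
  haveI : BorelSpace (UJ (alphaLoc a hw) (betaLoc b ε hw)) := ⟨rfl⟩
  set μ : Measure (UJ (alphaLoc a hw) (betaLoc b ε hw)) := Measure.map e ν with hμ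
  haveI : μ.IsHaarMeasure := ContinuousMulEquiv.isHaarMeasure_map ν e
  obtain ⟨C, hC, hT⟩ := haar_logSublevel_le_exp_UJ hα hβ μ (ε := 1 / 2) (by norm_num)
  set K : ℝ := 1 + ‖wroot q w₀‖ with hK
  have hK1 : 1 ≤ K := le_add_of_nonneg_right (norm_nonneg _)
  have hK0 : 0 < K := zero_lt_one.trans_le hK1
  have hlogK : 0 ≤ Real.log K := Real.log_nonneg hK1
  refine sliceBallGrowth_of_logSublevel (PlaneData.ofLinesRow q a b ε) w₀ ν (α := 2 + 1 / 2) (by norm_num)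
    ⟨C * K ^ (2 + 1 / 2 : ℝ), by positivity, fun T hT0 => ?_⟩
  -- the sublevel set of the slice lies in the preimage of the shifted sublevel set of `U(J)`
  have hsub : {h : atPlace (PlaneData.ofLinesRow q a b ε) w₀ |
      Real.log (max 1 (archSizeAt (PlaneData.ofLinesRow q a b ε) w₀ (h : GA (PlaneData.ofLinesRow q a b ε)))) ≤ T} ⊆
      e ⁻¹' {x : UJ (alphaLoc a hw) (betaLoc b ε hw) |
        Real.log (max 1 (l1C ((x : GL (Fin 2) ℂ) : Matrix (Fin 2) (Fin 2) ℂ))) ≤ T + Real.log K} := by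
    intro h hh
    simp only [Set.mem_setOf_eq, Set.mem_preimage] at hh ⊢
    set A := archSizeAt (PlaneData.ofLinesRow q a b ε) w₀ (h : GA (PlaneData.ofLinesRow q a b ε)) with hA
    have hm0 : (0 : ℝ) < max 1 A := lt_of_lt_of_le one_pos (le_max_left _ _)
    have hmT : max 1 A ≤ Real.exp T := (Real.log_le_iff_le_exp hm0).1 hh
    have hAT : A ≤ Real.exp T := (le_max_right _ _).trans hmT
    have hl : l1C (((e h : UJ (alphaLoc a hw) (betaLoc b ε hw)) : GL (Fin 2) ℂ) : Matrix (Fin 2) (Fin 2) ℂ) ≤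
        K * Real.exp T := by
      calc l1C (((e h : UJ (alphaLoc a hw) (betaLoc b ε hw)) : GL (Fin 2) ℂ) : Matrix (Fin 2) (Fin 2) ℂ)
          ≤ K * A := l1C_sliceModel_le q a b ε hw hcm hq h
        _ ≤ K * Real.exp T := mul_le_mul_of_nonneg_left hAT hK0.le
    have hexp : Real.exp (T + Real.log K) = K * Real.exp T := by
      rw [Real.exp_add, Real.exp_log hK0, mul_comm]
    have hm0' : (0 : ℝ) < max 1 (l1C (((e h : UJ (alphaLoc a hw) (betaLoc b ε hw)) : GL (Fin 2) ℂ) :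
        Matrix (Fin 2) (Fin 2) ℂ)) := lt_of_lt_of_le one_pos (le_max_left _ _)
    rw [Real.log_le_iff_le_exp hm0', hexp]
    refine max_le ?_ hl
    calc (1 : ℝ) = 1 * 1 := (mul_one 1).symm
      _ ≤ K * Real.exp T := mul_le_mul hK1 (Real.one_le_exp hT0) zero_le_one hK0.le
  have hmeq : Measure.map e ν = Measure.map e.toHomeomorph.toMeasurableEquiv ν := rfl
  have hmap : ∀ s : Set (UJ (alphaLoc a hw) (betaLoc b ε hw)), ν (e ⁻¹' s) = μ s := by
    intro s
    rw [hμ, hmeq, MeasurableEquiv.map_apply]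
    rfl
  have hpow : Real.exp ((2 + 1 / 2) * (T + Real.log K)) = K ^ (2 + 1 / 2 : ℝ) * Real.exp ((2 + 1 / 2) * T) := by
    rw [mul_add, Real.exp_add, Real.rpow_def_of_pos hK0, mul_comm (Real.log K), mul_comm]
  calc ν {h : atPlace (PlaneData.ofLinesRow q a b ε) w₀ |
        Real.log (max 1 (archSizeAt (PlaneData.ofLinesRow q a b ε) w₀ (h : GA (PlaneData.ofLinesRow q a b ε)))) ≤ T}
      ≤ ν (e ⁻¹' {x : UJ (alphaLoc a hw) (betaLoc b ε hw) |
          Real.log (max 1 (l1C ((x : GL (Fin 2) ℂ) : Matrix (Fin 2) (Fin 2) ℂ))) ≤ T + Real.log K}) :=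
        measure_mono hsub
    _ = μ {x : UJ (alphaLoc a hw) (betaLoc b ε hw) |
          Real.log (max 1 (l1C ((x : GL (Fin 2) ℂ) : Matrix (Fin 2) (Fin 2) ℂ))) ≤ T + Real.log K} := hmap _
    _ ≤ ENNReal.ofReal (C * Real.exp ((2 + 1 / 2) * (T + Real.log K))) := hT _ (add_nonneg hT0 hlogK)
    _ = ENNReal.ofReal (C * K ^ (2 + 1 / 2 : ℝ) * Real.exp ((2 + 1 / 2) * T)) := by
        rw [hpow]
        congr 1
        ring

/-- **The line's plane**: the mixed row plane `W_a ⊕ W_b⁻` with the transported second torus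
(`withTransportedTorus` keeps `B` and `Ω`, so its adelic group, its slices and `archSizeAt` are those of
`ofLinesRow q a b (−1)` by definition) — the `hslice` binder of `archBallGrowth_of_slice` in the shape the skeleton
and L1-p2's `hcpt_withTransportedTorus_of_iso` use.  The signs: `a_{w₀} > 0` and `(−b)_{w₀} < 0`, i.e. `a_{w₀}, b_{w₀} > 0`. -/
theorem sliceBallGrowth_mixedRow_withTransportedTorus (g g' : Matrix (Fin 4) (Fin 4) k) (hgg' : g * g' = 1)
    (hg'g : g' * g = 1) (hgΩ : g * (PlaneData.mixedRow q a b).Ω = (PlaneData.mixedRow q a b).Ω * g)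
    (hw : w₀.IsReal) (hcm : IsCMAt q w₀) (hq : 4 * q.n - q.t ^ 2 ≠ 0)
    (hα : 0 < alphaLoc a hw) (hβ : betaLoc b (-1) hw < 0)
    [hM : MeasurableSpace (GA ((PlaneData.mixedRow q a b).withTransportedTorus g g' hgg' hg'g hgΩ))]
    [hB : BorelSpace (GA ((PlaneData.mixedRow q a b).withTransportedTorus g g' hgg' hg'g hgΩ))]
    (ν : Measure (atPlace ((PlaneData.mixedRow q a b).withTransportedTorus g g' hgg' hg'g hgΩ) w₀))
    [hν : ν.IsHaarMeasure] :
    SliceBallGrowth ((PlaneData.mixedRow q a b).withTransportedTorus g g' hgg' hg'g hgΩ) w₀ ν :=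
  @sliceBallGrowth_ofLinesRow k _ _ q a b (-1) w₀ hw hcm hq hα hβ hM hB ν hν

end Slice

end Summit.Ventures.HodgeRepro.Tier4.Line4

end
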